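import Summits.CriticalPhenomena.PercolationContinuityZ3.Theorems.FK.BoxErgodicAveragesFK
import Summits.CriticalPhenomena.PercolationContinuityZ3.Theorems.FK.EdgeDensityLLN
import HarnessLib

/-!
# FK-continuity cell, FO-10a: the ALMOST-SURE open-edge density — `|ω ∩ E_{Λ_N}| / |Λ_N| → d · h^b(p,q)` for
# `φ^b_{p,q}`-a.e. `ω` (ergodic theorem for `φ^b_{p,q}` + the coordinate-edge squeeze)

Registered R114 (cell INBOX l.7615, 2026-08-25); registry row FO-10a-g342d; label EDG-A (coordinator fk-4 g228).
Cell `fk-continuity` (bschramm), row FO-10a (pressure layer); support file for the FK-continuity transplant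
(`--supports stmt-CriticalPhenomena-4575`); builds on p205010 (kernel theorem, internal audit signed; external expert
review pending). Pure proofs; no definitions, no named facts, no sorries; `d ≥ 1`, `0 ≤ p ≤ 1`, `q ≥ 1`, both boundary
conditions `b`. UNCONDITIONAL infinite-volume structure; it decides nothing about FH / TP_FK / the value of `h^b` at any `(p,q)`.

`EdgeDensityLLN.lean` proves the `L¹` / in-probability law `|ω ∩ E_{Λ_N}|/|Λ_N| → d h^b` from mixing, through the squeeze
`S(ω,Λ_{N−1}) ≤ |ω ∩ E_{Λ_N}| ≤ S(ω,Λ_N)`, `S(ω,Λ) = #{(x,i) ∈ Λ × [d] : ⟨x,x+e_i⟩ ∈ ω}`. Each direction's count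
`#{x ∈ Λ_N : ⟨x,x+e_i⟩ ∈ ω}` is the box frequency of the covariant family of events `{⟨x, x+e_i⟩ open} = {ω − x ∈ {⟨0,e_i⟩ open}}`,
so the ergodic theorem for `φ^b_{p,q}` (`BoxErgodicAveragesFK.ae_tendsto_boxDensity_covariant_rcLimit`) upgrades the law to
ALMOST-SURE convergence:

* `ae_tendsto_card_filter_coordEdge_div_card_box` — `|Λ_N|⁻¹ S(ω,Λ_N) → d φ^b_{p,q}(e₀ open)` for `φ^b_{p,q}`-a.e. `ω`;
* **`ae_tendsto_openEdges_div_card_box`** — `|Λ_N|⁻¹ |ω ∩ E_{Λ_N}| → d φ^b_{p,q}(e₀ open)` for `φ^b_{p,q}`-a.e. `ω`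
  (`d ≥ 1`, any lattice edge `e₀`; Grimmett 2006 (4.61): `h^b` does not depend on the edge).

## References

* G. Grimmett, *The Random-Cluster Model*, Springer 2006 (`book:grimmett2006-random-cluster-model`): §4.3 Cor. (4.23)
  [PDF p. 79]; (4.61) and the proof of Thm. (4.63), (4.74)–(4.76) [PDF pp. 86–88]. [Grimmett2006]
-/

noncomputable section

open MeasureTheory Set Filter Finset
open scoped Topology ENNReal

namespace Summit.CriticalPhenomena.PercolationContinuityZ3.Theorems.FK

open Literature.Probability.Percolation Literature.Probability.LatticeModels

variable {d : ℕ} {p q : ℝ}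

open Classical in
/-- **Almost surely `|Λ_N|⁻¹ #{(x,i) ∈ Λ_N × [d] : ⟨x,x+e_i⟩ ∈ ω} → d φ^b_{p,q}(e₀ open)`** (`d ≥ 1`, `e₀` a lattice edge): the
direction-by-direction box frequencies of the open coordinate edges. [cite: Grimmett2006, Cor. (4.23) with (4.61)] -/
theorem ae_tendsto_card_filter_coordEdge_div_card_box (hd : 1 ≤ d) (b : Bool) (hp : p ∈ Set.Icc (0 : ℝ) 1) (hq : 1 ≤ q)
    {e₀ : Sym2 (Site d)} (he₀ : e₀ ∈ (zdGraph d).edgeSet) :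
    ∀ᵐ ω ∂(rcLimit d b p q), Tendsto (fun N : ℕ => ((#(box d N) : ℝ))⁻¹ *
      #((box d N ×ˢ (Finset.univ : Finset (Fin d))).filter fun xi => s(xi.1, xi.1 + Pi.single xi.2 1) ∈ ω)) atTop
        (𝓝 (d * (rcLimit d b p q).real {ω | e₀ ∈ ω})) := by
  -- per direction `i`: the covariant family `A^i_x = {s(x, x+e_i) ∈ ω} = {ω − x ∈ {s(0,e_i) ∈ ω}}`
  have hdir : ∀ i : Fin d, ∀ᵐ ω ∂(rcLimit d b p q), Tendsto (fun N : ℕ => ((#(box d N) : ℝ))⁻¹ *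
      (#((box d N).filter fun x => s(x, x + Pi.single i 1) ∈ ω) : ℝ)) atTop (𝓝 ((rcLimit d b p q).real {ω | e₀ ∈ ω})) := by
    intro i
    have h := ae_tendsto_boxDensity_shift_neg_rcLimit hd b hp hq
      (measurableSet_of_isLocalEvent_holds (isLocalEvent_setOf_mem (s((0 : Site d), Pi.single i 1))))
    rw [rcLimit_real_setOf_mem_eq_of_mem_edgeSet b hp hq (coordEdge_zero_mem_edgeSet i) he₀] at h
    filter_upwards [h] with ω hω
    refine hω.congr fun N => ?_
    congr 2
    exact congrArg Finset.card (Finset.filter_congr fun x _ => mem_preimage_relabel_shift_neg_setOf_mem_iff x i ω)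
  rw [← ae_all_iff] at hdir
  filter_upwards [hdir] with ω hω
  have hsum := tendsto_finsetSum (Finset.univ : Finset (Fin d)) fun i _ => hω i
  rw [Finset.sum_const, Finset.card_univ, Fintype.card_fin, nsmul_eq_mul] at hsum
  refine hsum.congr fun N => ?_
  rw [← Finset.mul_sum]
  congr 1
  rw [← Nat.cast_sum, Nat.cast_inj, Finset.card_filter, Finset.sum_product_right]
  exact Finset.sum_congr rfl fun i _ => by rw [Finset.card_filter]

open Classical in
/-- **THE ALMOST-SURE OPEN-EDGE DENSITY: `|Λ_N|⁻¹ |ω ∩ E_{Λ_N}| → d φ^b_{p,q}(e₀ open)` for `φ^b_{p,q}`-a.e. `ω`** (`d ≥ 1`,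
`0 ≤ p ≤ 1`, `q ≥ 1`, both `b`, any lattice edge `e₀`); with `|E_{Λ_N}|/|Λ_N| → d` this is `|ω ∩ E_{Λ_N}|/|E_{Λ_N}| → h^b(p,q)`
almost surely. [cite: Grimmett2006, Cor. (4.23) with (4.61), (4.74)–(4.76)] -/
theorem ae_tendsto_openEdges_div_card_box (hd : 1 ≤ d) (b : Bool) (hp : p ∈ Set.Icc (0 : ℝ) 1) (hq : 1 ≤ q)
    {e₀ : Sym2 (Site d)} (he₀ : e₀ ∈ (zdGraph d).edgeSet) :
    ∀ᵐ ω ∂(rcLimit d b p q), Tendsto (fun N : ℕ => ((#(box d N) : ℝ))⁻¹ *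
      #((edgesIn (zdGraph d) (box d N)).filter fun e => e ∈ ω)) atTop (𝓝 (d * (rcLimit d b p q).real {ω | e₀ ∈ ω})) := by
  filter_upwards [ae_tendsto_card_filter_coordEdge_div_card_box hd b hp hq he₀] with ω hω
  set c : ℝ := d * (rcLimit d b p q).real {ω | e₀ ∈ ω} with hc
  -- the lower comparison sequence `|Λ_N|⁻¹ S(ω, Λ_{N-1}) = r_N · |Λ_{N-1}|⁻¹ S(ω, Λ_{N-1})`, `r_N → 1`
  have hlow : Tendsto (fun N : ℕ => ((#(box d N) : ℝ))⁻¹ *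
      #((box d (N - 1) ×ˢ (Finset.univ : Finset (Fin d))).filter fun xi => s(xi.1, xi.1 + Pi.single xi.2 1) ∈ ω))
      atTop (𝓝 c) := by
    have h1 := (hω.comp (tendsto_sub_atTop_nat 1)).mul (tendsto_card_box_sub_div_card_box (d := d) 1)
    rw [mul_one] at h1
    refine h1.congr fun N => ?_
    have hpos' : (0 : ℝ) < #(box d (N - 1)) := by exact_mod_cast Finset.card_pos.2 (box_nonempty d (N - 1))
    simp only [Function.comp_apply]
    field_simp
  refine tendsto_of_tendsto_of_tendsto_of_le_of_le' hlow hω ?_ ?_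
  · filter_upwards [eventually_ge_atTop 1] with N hN
    exact mul_le_mul_of_nonneg_left (by exact_mod_cast card_filter_coordEdge_box_pred_le hN ω)
      (inv_nonneg.2 (Nat.cast_nonneg _))
  · exact Eventually.of_forall fun N => mul_le_mul_of_nonneg_left
      (by exact_mod_cast card_filter_edgesIn_le_card_filter_coordEdge (box d N) ω) (inv_nonneg.2 (Nat.cast_nonneg _))

end Summit.CriticalPhenomena.PercolationContinuityZ3.Theorems.FK

end
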